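import Mathlib.Analysis.SumIntegralComparisons
import Mathlib.Analysis.Complex.ExponentialBounds
import Literature.NumberTheory.LFunctions.LagariasRains2003.Representation
import Literature.NumberTheory.LFunctions.LagariasRains2003.Certificate
import HarnessLib

/-!
# Lagarias–Rains (2003), §7.3 Question 1 — answered in the negative

[LagariasRains2003, §7.3]: "Question 1. Is `Re(Z(w, s)) > 0` in the entire real-codimension one
cone `C⁻ := {(w, s) : w = u ∈ ℝ, u < Re(s) < 0}`?" **No**: at `(w, s) = (−16, −1/100 + i) ∈ C⁻`
one has `Re Z_ℚ(w, s) < 0` (`re_ZQ_lt_zero`; numerically `Re Z_ℚ = −0.0856…`), hence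
`not_question1 : ¬ Question1`.

Proof. By Theorem 2.1 (`ZQ_eq`), `Re Z_ℚ(−16, −1/100 + i) = 100/10001 + 159900/2566801 − ∫_1^∞ h`,
`h(t) = (1 − θ(t²)^{−16})(t^{−1.01} + t^{−16.99}) cos(log t)` (`re_Phi`). On `[1, 2]` each factor
of `h` is non-negative and non-increasing (`θ` is decreasing, `log 2 < π/2`), so `∫_1^2 h` is at
least the right-endpoint Riemann sum with 64 nodes (`AntitoneOn.sum_le_integral`), which the kernel
certificate `certZQ16_true` bounds below by `100/10001 + 159900/2566801 + 1/1000`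
(`certZQ16_sound`); and `|∫_2^∞ Re Φ| ≤ ∫_2^∞ 128 e^{−2πt} dt < 1/1000` (`norm_Phi_le`).
Standard axioms only (`decide +kernel` in `LagariasRains2003.Certificate`).
-/

open MeasureTheory Set Filter Topology Complex
open Literature.Analysis.ValidatedNumerics Literature.Analysis.ValidatedNumerics.NumericsMP

namespace Literature.NumberTheory.LFunctions.LagariasRains2003

/-! ## The point `(−16, −1/100 + i)` and the real integrand `h` -/

/-- `w₀ = −16`. [cite: LagariasRains2003, §7.3 Question 1] -/
noncomputable def wPt : ℂ := -16

/-- `s₀ = −1/100 + i`. [cite: LagariasRains2003, §7.3 Question 1] -/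
noncomputable def sPt : ℂ := ⟨-1 / 100, 1⟩

/-- `(w₀, s₀) ∈ C⁻`. [cite: LagariasRains2003, §7.3 Question 1] -/
theorem pt_mem_coneMinus : (wPt, sPt) ∈ coneMinus :=
  ⟨-16, by simp [wPt], by norm_num [sPt], by norm_num [sPt]⟩

/-- `1 − θ(t²)^{−16}`. [cite: LagariasRains2003, §7.3 Question 1] -/
noncomputable def facA (t : ℝ) : ℝ := 1 - (theta (t ^ 2) ^ 16)⁻¹

/-- `t^{−101/100} + t^{−1699/100}`. [cite: LagariasRains2003, §7.3 Question 1] -/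
noncomputable def facB (t : ℝ) : ℝ := t ^ (-(101 / 100) : ℝ) + t ^ (-(1699 / 100) : ℝ)

/-- `cos (log t)`. [cite: LagariasRains2003, §7.3 Question 1] -/
noncomputable def facC (t : ℝ) : ℝ := Real.cos (Real.log t)

/-- `h(t) = (1 − θ(t²)^{−16})(t^{−1.01} + t^{−16.99}) cos(log t) = −Re Φ(t)`.
[cite: LagariasRains2003, §7.3 Question 1] -/
noncomputable def hfun (t : ℝ) : ℝ := facA t * facB t * facC t

/-- The integrand of Theorem 2.1 at `(w₀, s₀)`. [cite: LagariasRains2003, Thm. 2.1] -/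
noncomputable def Phi (t : ℝ) : ℂ :=
  ((theta (t ^ 2) : ℂ) ^ wPt - 1) * ((t : ℂ) ^ (sPt - 1) + (t : ℂ) ^ (wPt - sPt - 1))

/-- `Re t^z = t^{Re z} cos(Im z · log t)` for `t > 0`. [folklore] -/
private theorem re_ofReal_cpow {t : ℝ} (ht : 0 < t) (z : ℂ) :
    ((t : ℂ) ^ z).re = t ^ z.re * Real.cos (z.im * Real.log t) := by
  rw [cpow_def_of_ne_zero (ofReal_ne_zero.mpr ht.ne'), ← ofReal_log ht.le, exp_re, re_ofReal_mul,
    im_ofReal_mul, Real.rpow_def_of_pos ht, mul_comm z.im]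

/-- `|t^z| ≤ 1` for `t ≥ 1`, `Re z ≤ 0`. [folklore] -/
private theorem norm_ofReal_cpow_le_one {t : ℝ} (ht : 1 ≤ t) {z : ℂ} (hz : z.re ≤ 0) :
    ‖(t : ℂ) ^ z‖ ≤ 1 := by
  rw [norm_cpow_eq_rpow_re_of_pos (by linarith) z]
  exact Real.rpow_le_one_of_one_le_of_nonpos ht hz

/-- `θ(t²)^{w₀} = (θ(t²)^16)⁻¹` (a positive real). [folklore] -/
private theorem thetaSq_cpow_wPt (t : ℝ) (_ht : 0 < t) :
    (theta (t ^ 2) : ℂ) ^ wPt = (((theta (t ^ 2) ^ 16)⁻¹ : ℝ) : ℂ) := by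
  have : (wPt : ℂ) = -((16 : ℕ) : ℂ) := by simp [wPt]
  rw [this, cpow_neg, cpow_natCast]
  push_cast
  rfl

/-- `Re Φ(t) = −h(t)` for `t > 0`. [cite: LagariasRains2003, §7.3 Question 1] -/
theorem re_Phi {t : ℝ} (ht : 0 < t) : (Phi t).re = -hfun t := by
  unfold Phi hfun facA facB facC
  rw [thetaSq_cpow_wPt t ht,
    show (((theta (t ^ 2) ^ 16)⁻¹ : ℝ) : ℂ) - 1 = (((theta (t ^ 2) ^ 16)⁻¹ - 1 : ℝ) : ℂ) by
      push_cast; ring,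
    re_ofReal_mul, add_re, re_ofReal_cpow ht, re_ofReal_cpow ht]
  have h1 : (sPt - 1).re = -(101 / 100) := by norm_num [sPt]
  have h2 : (sPt - 1).im = 1 := by norm_num [sPt]
  have h3 : (wPt - sPt - 1).re = -(1699 / 100) := by norm_num [sPt, wPt]
  have h4 : (wPt - sPt - 1).im = -1 := by norm_num [sPt, wPt]
  rw [h1, h2, h3, h4, one_mul, neg_one_mul, Real.cos_neg]
  ring

/-! ## `h` is non-negative and non-increasing on `[1, 2]` -/

/-- `1 − θ(t²)^{−16} ≥ 0` (`θ ≥ 1`). [folklore] -/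
private theorem facA_nonneg {t : ℝ} (ht : 0 < t) : 0 ≤ facA t :=
  sub_nonneg.mpr (inv_le_one_of_one_le₀ (one_le_pow₀ (one_le_theta (by positivity))))

/-- `t ↦ 1 − θ(t²)^{−16}` is non-increasing on `(0, ∞)` (`θ` is). [folklore] -/
private theorem facA_anti {a b : ℝ} (ha : 0 < a) (hab : a ≤ b) : facA b ≤ facA a := by
  unfold facA
  have hb : 0 < b := lt_of_lt_of_le ha hab
  have hθ : theta (b ^ 2) ≤ theta (a ^ 2) :=
    theta_antitoneOn (show a ^ 2 ∈ Ioi 0 by simp only [mem_Ioi]; positivity)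
      (show b ^ 2 ∈ Ioi 0 by simp only [mem_Ioi]; positivity) (pow_le_pow_left₀ ha.le hab 2)
  have hθb : 0 < theta (b ^ 2) := theta_pos (by positivity)
  have h16 : theta (b ^ 2) ^ 16 ≤ theta (a ^ 2) ^ 16 := pow_le_pow_left₀ hθb.le hθ 16
  have := inv_anti₀ (pow_pos hθb 16) h16
  linarith

/-- `t^{−1.01} + t^{−16.99} ≥ 0`. [folklore] -/
private theorem facB_nonneg {t : ℝ} (ht : 0 < t) : 0 ≤ facB t :=
  add_nonneg (Real.rpow_nonneg ht.le _) (Real.rpow_nonneg ht.le _)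

/-- `t ↦ t^{−1.01} + t^{−16.99}` is non-increasing on `(0, ∞)`. [folklore] -/
private theorem facB_anti {a b : ℝ} (ha : 0 < a) (hab : a ≤ b) : facB b ≤ facB a :=
  add_le_add (Real.rpow_le_rpow_of_nonpos ha hab (by norm_num))
    (Real.rpow_le_rpow_of_nonpos ha hab (by norm_num))

/-- `log t ≤ 7/10` for `0 < t ≤ 2`. [folklore] -/
private theorem log_le_of_le_two {t : ℝ} (h0 : 0 < t) (h2 : t ≤ 2) : Real.log t ≤ 7 / 10 :=
  (Real.log_le_log h0 h2).trans (by linarith [Real.log_two_lt_d9])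

/-- `cos (log t) ≥ 0` on `[1, 2]` (`log 2 < π/2`). [folklore] -/
private theorem facC_nonneg {t : ℝ} (h1 : 1 ≤ t) (h2 : t ≤ 2) : 0 ≤ facC t := by
  unfold facC
  refine Real.cos_nonneg_of_mem_Icc ⟨?_, ?_⟩
  · linarith [Real.log_nonneg h1, Real.pi_pos]
  · linarith [log_le_of_le_two (by linarith) h2, Real.pi_gt_three]

/-- `t ↦ cos (log t)` is non-increasing on `[1, 2]`. [folklore] -/
private theorem facC_anti {a b : ℝ} (ha : 1 ≤ a) (hab : a ≤ b) (hb : b ≤ 2) : facC b ≤ facC a := by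
  unfold facC
  exact Real.cos_le_cos_of_nonneg_of_le_pi (Real.log_nonneg ha)
    (by linarith [log_le_of_le_two (by linarith) hb, Real.pi_gt_three])
    (Real.log_le_log (by linarith) hab)

/-- `h ≥ 0` on `[1, 2]`. [cite: LagariasRains2003, §7.3 Question 1] -/
theorem hfun_nonneg {t : ℝ} (h1 : 1 ≤ t) (h2 : t ≤ 2) : 0 ≤ hfun t :=
  mul_nonneg (mul_nonneg (facA_nonneg (by linarith)) (facB_nonneg (by linarith))) (facC_nonneg h1 h2)

/-- `h` is non-increasing on `[1, 2]`. [cite: LagariasRains2003, §7.3 Question 1] -/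
theorem hfun_antitoneOn : AntitoneOn hfun (Icc 1 2) := by
  intro a ha b hb hab
  simp only [mem_Icc] at ha hb
  unfold hfun
  have ha0 : 0 < a := by linarith
  exact mul_le_mul (mul_le_mul (facA_anti ha0 hab) (facB_anti ha0 hab) (facB_nonneg (by linarith))
    (facA_nonneg ha0)) (facC_anti ha.1 hab hb.2) (facC_nonneg hb.1 hb.2)
    (mul_nonneg (facA_nonneg ha0) (facB_nonneg ha0))

/-- Right-endpoint Riemann sum with 64 nodes: `Σ_{i<64} h(1 + (i+1)/64) ≤ 64 ∫_1^2 h`.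
[cite: LagariasRains2003, §7.3 Question 1] -/
theorem sum_le_integral_hfun :
    ∑ i ∈ Finset.range 64, hfun (1 + ((i : ℝ) + 1) / 64) ≤ 64 * ∫ t in (1 : ℝ)..2, hfun t := by
  have hanti : AntitoneOn (fun u : ℝ => hfun (u / 64 + 1)) (Icc (0 : ℝ) ((0 : ℝ) + (64 : ℕ))) := by
    intro u hu v hv huv
    simp only [mem_Icc] at hu hv
    push_cast at hu hv
    exact hfun_antitoneOn ⟨by linarith, by linarith⟩ ⟨by linarith, by linarith⟩ (by linarith)
  have h1 := AntitoneOn.sum_le_integral hanti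
  have h2 : ∫ x in (0 : ℝ)..(0 : ℝ) + (64 : ℕ), hfun (x / 64 + 1) = 64 * ∫ t in (1 : ℝ)..2, hfun t := by
    rw [intervalIntegral.integral_comp_div_add (fun t => hfun t) (by norm_num : (64 : ℝ) ≠ 0) 1]
    norm_num
  rw [h2] at h1
  convert h1 using 2 with i _
  push_cast
  ring_nf

/-! ## The tail `t ≥ 2` -/

/-- `1 − u^{−16} ≤ 16 (u − 1)` for `u ≥ 1`. [folklore] -/
private theorem one_sub_inv_pow_le {u : ℝ} (hu : 1 ≤ u) : 1 - (u ^ 16)⁻¹ ≤ 16 * (u - 1) := by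
  have hu0 : 0 < u := by linarith
  have h1 : (u ^ 16)⁻¹ = Real.exp (-(16 * Real.log u)) := by
    rw [Real.exp_neg, show (16 : ℝ) * Real.log u = (16 : ℕ) * Real.log u by norm_num,
      Real.exp_nat_mul, Real.exp_log hu0]
  have h2 : -(16 * Real.log u) + 1 ≤ Real.exp (-(16 * Real.log u)) := Real.add_one_le_exp _
  have h3 : Real.log u ≤ u - 1 := Real.log_le_sub_one_of_pos hu0
  rw [h1]
  linarith

/-- For `t ≥ 2`: `|Φ(t)| ≤ 128 e^{−2πt}`. [cite: LagariasRains2003, §7.3 Question 1] -/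
theorem norm_Phi_le {t : ℝ} (ht : 2 ≤ t) : ‖Phi t‖ ≤ 128 * Real.exp (-(2 * Real.pi) * t) := by
  have ht0 : 0 < t := by linarith
  have hT : 0 < t ^ 2 := by positivity
  set r := Real.exp (-Real.pi * t ^ 2) with hr
  have hr0 : 0 < r := Real.exp_pos _
  have hr1 : r ≤ 1 / 13 := by
    have h12 : (13 : ℝ) ≤ Real.exp 12 := by linarith [Real.add_one_le_exp (12 : ℝ)]
    have : r ≤ Real.exp (-12) := Real.exp_le_exp.mpr (by nlinarith [Real.pi_gt_three])
    rw [Real.exp_neg] at this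
    exact this.trans (by rw [inv_eq_one_div]; exact one_div_le_one_div_of_le (by norm_num) h12)
  -- θ(t²) − 1 ≤ 4 r
  have hθ1 : theta (t ^ 2) - 1 ≤ 4 * r := by
    have := theta_sub_one_le hT
    rw [← hr] at this
    refine this.trans ?_
    rw [div_le_iff₀ (by linarith)]
    nlinarith
  have hθge : 1 ≤ theta (t ^ 2) := one_le_theta hT
  -- the first factor
  have hF1 : ‖(theta (t ^ 2) : ℂ) ^ wPt - 1‖ ≤ 64 * r := by
    rw [thetaSq_cpow_wPt t ht0,
      show (((theta (t ^ 2) ^ 16)⁻¹ : ℝ) : ℂ) - 1 = (((theta (t ^ 2) ^ 16)⁻¹ - 1 : ℝ) : ℂ) by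
        push_cast; ring, norm_real, Real.norm_eq_abs,
      abs_of_nonpos (by
        have := inv_le_one_of_one_le₀ (one_le_pow₀ (M₀ := ℝ) hθge (n := 16)); linarith)]
    have := one_sub_inv_pow_le hθge
    linarith
  -- the second factor
  have hF2 : ‖(t : ℂ) ^ (sPt - 1) + (t : ℂ) ^ (wPt - sPt - 1)‖ ≤ 2 := by
    refine (norm_add_le _ _).trans ?_
    have h1 := norm_ofReal_cpow_le_one (by linarith : (1 : ℝ) ≤ t) (z := sPt - 1) (by norm_num [sPt])
    have h2 := norm_ofReal_cpow_le_one (by linarith : (1 : ℝ) ≤ t) (z := wPt - sPt - 1)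
      (by norm_num [sPt, wPt])
    linarith
  -- e^{−π t²} ≤ e^{−2π t}
  have hexp : r ≤ Real.exp (-(2 * Real.pi) * t) := by
    refine Real.exp_le_exp.mpr ?_
    have h2t : 2 * t ≤ t ^ 2 := by nlinarith
    have := mul_le_mul_of_nonneg_left h2t Real.pi_pos.le
    linarith
  calc ‖Phi t‖ = ‖(theta (t ^ 2) : ℂ) ^ wPt - 1‖ * ‖(t : ℂ) ^ (sPt - 1) + (t : ℂ) ^ (wPt - sPt - 1)‖ :=
        norm_mul _ _
    _ ≤ 64 * r * 2 := mul_le_mul hF1 hF2 (norm_nonneg _) (by positivity)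
    _ ≤ 128 * Real.exp (-(2 * Real.pi) * t) := by nlinarith

/-- `∫_2^∞ Re Φ < 1/1000`. [cite: LagariasRains2003, §7.3 Question 1] -/
theorem integral_tail_lt :
    ∫ t in Ioi (2 : ℝ), (Phi t).re < 1 / 1000 := by
  have hws : wPt.re < sPt.re := by norm_num [wPt, sPt]
  have hs : sPt.re < 0 := by norm_num [sPt]
  have h3 : IntegrableOn Phi (Ioi 1) := integrableOn_thetaPowSubOne_mul hws hs
  have hint : IntegrableOn (fun t => (Phi t).re) (Ioi 2) :=
    (h3.mono_set (Ioi_subset_Ioi (by norm_num))).re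
  have hg : IntegrableOn (fun t : ℝ => 128 * Real.exp (-(2 * Real.pi) * t)) (Ioi 2) :=
    (exp_neg_integrableOn_Ioi 2 (by positivity)).const_mul 128
  have hle : ∫ t in Ioi (2 : ℝ), (Phi t).re ≤ ∫ t in Ioi (2 : ℝ), 128 * Real.exp (-(2 * Real.pi) * t) :=
    setIntegral_mono_on hint hg measurableSet_Ioi fun t ht =>
      (re_le_norm _).trans (norm_Phi_le (le_of_lt ht))
  have hval : ∫ t in Ioi (2 : ℝ), 128 * Real.exp (-(2 * Real.pi) * t) =
      128 * (Real.exp (-(2 * Real.pi) * 2) / (2 * Real.pi)) := by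
    rw [integral_const_mul, integral_exp_mul_Ioi (by linarith [Real.pi_pos]) 2]
    congr 1
    field_simp
  have hexp : Real.exp (-(2 * Real.pi) * 2) ≤ 1 / 150000 := by
    have h1 : Real.exp (-(2 * Real.pi) * 2) ≤ Real.exp (-12) :=
      Real.exp_le_exp.mpr (by linarith [Real.pi_gt_three])
    have h2 : (150000 : ℝ) ≤ Real.exp 12 := by
      have h := pow_le_pow_left₀ (by norm_num) (le_of_lt Real.exp_one_gt_d9) 12
      rw [Real.exp_one_pow] at h
      exact le_trans (by norm_num) h
    rw [Real.exp_neg] at h1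
    exact h1.trans (by rw [inv_eq_one_div]; exact one_div_le_one_div_of_le (by norm_num) h2)
  have hpi : 1 / (2 * Real.pi) ≤ 1 / 6 := one_div_le_one_div_of_le (by norm_num) (by linarith [Real.pi_gt_three])
  calc ∫ t in Ioi (2 : ℝ), (Phi t).re ≤ 128 * (Real.exp (-(2 * Real.pi) * 2) / (2 * Real.pi)) := by
        rw [← hval]; exact hle
    _ = 128 * (Real.exp (-(2 * Real.pi) * 2) * (1 / (2 * Real.pi))) := by ring
    _ ≤ 128 * ((1 / 150000) * (1 / 6)) := by
        gcongr
    _ < 1 / 1000 := by norm_num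

/-! ## Soundness of the kernel certificate -/

/-- `0 < PREC`. [folklore] -/
private theorem PREC_pos : 0 < PREC := by unfold PREC; positivity

/-- Integer division rounds down: `↑(x / y) ≤ ↑x / ↑y` for `y > 0`. [folklore] -/
private theorem cast_ediv_le (x : ℤ) {y : ℤ} (hy : 0 < y) : ((x / y : ℤ) : ℝ) ≤ (x : ℝ) / y := by
  rw [le_div_iff₀ (by exact_mod_cast hy)]
  exact_mod_cast Int.ediv_mul_le x hy.ne'

/-- `↑(max x 0) ≤ y` from `↑x ≤ y` and `0 ≤ y`. [folklore] -/
private theorem cast_max_zero_le {x : ℤ} {y : ℝ} (h : (x : ℝ) ≤ y) (hy : 0 ≤ y) :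
    ((max x 0 : ℤ) : ℝ) ≤ y := by
  rw [Int.cast_max, Int.cast_zero]; exact max_le h hy

/-- `logRatio n ∋ log (n/64)`. [folklore] -/
private theorem logRatio_sound {n : ℕ} (hn : 0 < n) {L : MI} (h : logRatio n = some L) :
    MI.mem PREC (Real.log ((n : ℝ) / 64)) L := by
  unfold logRatio at h
  split at h
  · rename_i A B hA hB
    simp only [Option.some.injEq] at h
    subst h
    rw [Real.log_div (by exact_mod_cast hn.ne') (by norm_num),
      show (64 : ℝ) = ((64 : ℕ) : ℝ) by norm_num]
    exact MI.mem_sub (MI.mem_logNat PREC_pos hA) (MI.mem_logNat PREC_pos hB)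
  · simp at h

/-- Soundness of `nodeParts`. [folklore] -/
private theorem nodeParts_sound {P : MI} (hP : MI.mem PREC Real.pi P) {n : ℕ} (hn1 : 64 ≤ n)
    (hn2 : n ≤ 128) {a b c : ℤ} (h : nodeParts P n = some (a, b, c)) :
    (0 ≤ a ∧ (a : ℝ) ≤ facA ((n : ℝ) / 64) * PREC) ∧ (0 ≤ b ∧ (b : ℝ) ≤ facB ((n : ℝ) / 64) * PREC) ∧
      (0 ≤ c ∧ (c : ℝ) ≤ facC ((n : ℝ) / 64) * PREC) := by
  have hS := PREC_pos
  have hSr : (0 : ℝ) < PREC := by exact_mod_cast hS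
  have hn : 0 < n := by omega
  set t : ℝ := (n : ℝ) / 64 with ht
  have ht1 : 1 ≤ t := by
    rw [ht, le_div_iff₀ (by norm_num)]; exact_mod_cast (show 1 * 64 ≤ n by omega)
  have ht2 : t ≤ 2 := by
    rw [ht, div_le_iff₀ (by norm_num)]; exact_mod_cast (show n ≤ 2 * 64 by omega)
  have ht0 : 0 < t := by positivity
  have hT : 0 < t ^ 2 := by positivity
  unfold nodeParts at h
  dsimp only at h
  split at h
  · rename_i E L hE hL
    split_ifs at h with hP16
    · split at h
      · rename_i E1 E2 C hE1 hE2 hC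
        simp only [Option.some.injEq, Prod.mk.injEq] at h
        obtain ⟨rfl, rfl, rfl⟩ := h
        have hLm : MI.mem PREC (Real.log t) L := logRatio_sound hn hL
        -- e^{-π t²}
        have hEm : MI.mem PREC (Real.exp (-Real.pi * t ^ 2)) E := by
          have := MI.mem_exp hS hE (MI.mem_neg (MI.mem_mul hS hP
            (MI.mem_ofFrac PREC ((n * n : ℕ) : ℤ) (q := 4096) (by norm_num))))
          convert this using 2
          rw [ht]; push_cast; ring
        set q : ℤ := max E.lo 0 with hq
        have hq0 : 0 ≤ q := le_max_right _ _
        have hqle : (q : ℝ) ≤ Real.exp (-Real.pi * t ^ 2) * PREC :=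
          cast_max_zero_le hEm.1 (by positivity)
        -- u = 1 + 2q/PREC ≤ θ(t²)
        set u : ℝ := (((PREC : ℤ) + 2 * q : ℤ) : ℝ) / PREC with hu
        have hq0r : (0 : ℝ) ≤ q := by exact_mod_cast hq0
        have hu1 : 1 ≤ u := by
          rw [hu, le_div_iff₀ hSr]; push_cast; linarith
        have hu0 : 0 < u := by linarith
        have huθ : u ≤ theta (t ^ 2) := by
          have h1 := one_add_le_theta hT
          have : u = 1 + 2 * ((q : ℝ) / PREC) := by rw [hu]; field_simp; push_cast; ring
          rw [this]
          have : (q : ℝ) / PREC ≤ Real.exp (-Real.pi * t ^ 2) := by rw [div_le_iff₀ hSr]; exact hqle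
          linarith
        have hu16 : MI.mem PREC (u ^ 16) (MI.sqrIter PREC 4 (MI.ofScaled ((PREC : ℤ) + 2 * q))) := by
          have := MI.mem_sqrIter hS 4 (MI.mem_ofScaled hS ((PREC : ℤ) + 2 * q))
          rw [← hu] at this
          simpa using this
        set P16 : ℤ := (MI.sqrIter PREC 4 (MI.ofScaled ((PREC : ℤ) + 2 * q))).lo with hP16def
        have hP16r : (0 : ℝ) < P16 := by exact_mod_cast hP16
        have hP16le : (P16 : ℝ) ≤ u ^ 16 * PREC := hu16.1
        refine ⟨⟨le_max_right _ _, cast_max_zero_le ?_ (mul_nonneg (facA_nonneg ht0) hSr.le)⟩,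
          ⟨le_max_right _ _, cast_max_zero_le ?_ (mul_nonneg (facB_nonneg ht0) hSr.le)⟩,
          ⟨le_max_right _ _, cast_max_zero_le ?_ ?_⟩⟩
        · -- a
          have hθ0 : 0 < theta (t ^ 2) := theta_pos hT
          have h1 : (theta (t ^ 2) ^ 16)⁻¹ ≤ (u ^ 16)⁻¹ :=
            inv_anti₀ (pow_pos hu0 16) (pow_le_pow_left₀ hu0.le huθ 16)
          have h2 : (u ^ 16)⁻¹ ≤ (PREC : ℝ) / P16 := by
            rw [inv_eq_one_div, div_le_div_iff₀ (pow_pos hu0 16) hP16r]; linarith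
          have h3 : (PREC : ℝ) / P16 ≤ (Numerics.cdiv ((PREC : ℤ) * PREC) P16 : ℝ) / PREC := by
            rw [le_div_iff₀ hSr]
            have := Numerics.div_le_cdiv (a := (PREC : ℤ) * PREC) hP16
            push_cast at this
            calc (PREC : ℝ) / P16 * PREC = (PREC : ℝ) * PREC / P16 := by ring
              _ ≤ _ := this
          unfold facA
          push_cast
          have : (Numerics.cdiv ((PREC : ℤ) * PREC) P16 : ℝ) ≥ (theta (t ^ 2) ^ 16)⁻¹ * PREC := by
            have := (h1.trans h2).trans h3
            rwa [ge_iff_le, ← le_div_iff₀ hSr]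
          linarith
        · -- b
          have m1 := MI.mem_exp hS hE1 (MI.mem_divNat (MI.mem_mulInt hLm (-101)) (n := 100) (by norm_num))
          have m2 := MI.mem_exp hS hE2 (MI.mem_divNat (MI.mem_mulInt hLm (-1699)) (n := 100) (by norm_num))
          have e1 : Real.exp (Real.log t * ((-101 : ℤ) : ℝ) / ((100 : ℕ) : ℝ)) = t ^ (-(101 / 100) : ℝ) := by
            rw [Real.rpow_def_of_pos ht0]; congr 1; push_cast; ring
          have e2 : Real.exp (Real.log t * ((-1699 : ℤ) : ℝ) / ((100 : ℕ) : ℝ)) = t ^ (-(1699 / 100) : ℝ) := by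
            rw [Real.rpow_def_of_pos ht0]; congr 1; push_cast; ring
          rw [e1] at m1
          rw [e2] at m2
          unfold facB
          push_cast
          have := m1.1
          have := m2.1
          linarith
        · -- c
          have m := MC.mem_expI hS hP hC hLm
          have := m.1.1
          rw [exp_ofReal_mul_I_re] at this
          unfold facC
          exact this
        · exact mul_nonneg (facC_nonneg ht1 ht2) hSr.le
      · simp at h
  · simp at h

/-- Soundness of `nodeLo`: `nodeLo P n ≤ PREC · h(n/64)` for `64 ≤ n ≤ 128`. [folklore] -/
private theorem nodeLo_sound {P : MI} (hP : MI.mem PREC Real.pi P) {n : ℕ} (hn1 : 64 ≤ n)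
    (hn2 : n ≤ 128) {v : ℤ} (h : nodeLo P n = some v) :
    (v : ℝ) ≤ hfun ((n : ℝ) / 64) * PREC := by
  have hSr : (0 : ℝ) < PREC := by exact_mod_cast PREC_pos
  have hSz : (0 : ℤ) < PREC := by exact_mod_cast PREC_pos
  unfold nodeLo at h
  split at h
  · rename_i a b c hparts
    simp only [Option.some.injEq] at h
    subst h
    obtain ⟨⟨ha0, ha⟩, ⟨hb0, hb⟩, ⟨hc0, hc⟩⟩ := nodeParts_sound hP hn1 hn2 hparts
    have ha0r : (0 : ℝ) ≤ a := by exact_mod_cast ha0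
    have hb0r : (0 : ℝ) ≤ b := by exact_mod_cast hb0
    have hc0r : (0 : ℝ) ≤ c := by exact_mod_cast hc0
    have hA0 : 0 ≤ facA ((n : ℝ) / 64) * PREC := ha0r.trans ha
    have hB0 : 0 ≤ facB ((n : ℝ) / 64) * PREC := hb0r.trans hb
    have h1 : ((a * b / (PREC : ℤ) : ℤ) : ℝ) ≤ (a : ℝ) * b / PREC := by
      have := cast_ediv_le (a * b) hSz; push_cast at this; exact this
    have h1' : (0 : ℝ) ≤ ((a * b / (PREC : ℤ) : ℤ) : ℝ) := by
      exact_mod_cast Int.ediv_nonneg (mul_nonneg ha0 hb0) hSz.le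
    have h2 : ((a * b / (PREC : ℤ) * c / (PREC : ℤ) : ℤ) : ℝ) ≤
        ((a * b / (PREC : ℤ) : ℤ) : ℝ) * c / PREC := by
      have := cast_ediv_le (a * b / (PREC : ℤ) * c) hSz; push_cast at this; exact this
    have h3 : ((a * b / (PREC : ℤ) : ℤ) : ℝ) * c / PREC ≤ ((a : ℝ) * b / PREC) * c / PREC := by
      gcongr
    have h4 : ((a : ℝ) * b / PREC) * c / PREC ≤
        (facA ((n : ℝ) / 64) * PREC) * (facB ((n : ℝ) / 64) * PREC) / PREC *
          (facC ((n : ℝ) / 64) * PREC) / PREC := by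
      gcongr
    have h5 : (facA ((n : ℝ) / 64) * PREC) * (facB ((n : ℝ) / 64) * PREC) / PREC *
          (facC ((n : ℝ) / 64) * PREC) / PREC = hfun ((n : ℝ) / 64) * PREC := by
      unfold hfun; field_simp
    linarith
  · simp at h

/-- Soundness of `sumLo`. [folklore] -/
private theorem sumLo_sound {P : MI} (hP : MI.mem PREC Real.pi P) :
    ∀ (N : ℕ), N ≤ 64 → ∀ {T : ℤ}, sumLo P N = some T →
      (T : ℝ) ≤ PREC * ∑ i ∈ Finset.range N, hfun (((65 + i : ℕ) : ℝ) / 64)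
  | 0, _, T, h => by
    simp only [sumLo, Option.some.injEq] at h
    subst h
    simp
  | N + 1, hN, T, h => by
    unfold sumLo at h
    split at h
    · rename_i a b ha hb
      simp only [Option.some.injEq] at h
      subst h
      have h1 := sumLo_sound hP N (by omega) ha
      have h2 := nodeLo_sound hP (by omega) (by omega) hb
      rw [Finset.sum_range_succ, mul_add]
      push_cast at h1 h2 ⊢
      linarith
    · simp at h

/-- **Soundness of the certificate**:
`64 · (100/10001 + 159900/2566801 + 1/1000) ≤ Σ_{i<64} h(1 + (i+1)/64)`.
[cite: LagariasRains2003, §7.3 Question 1] -/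
theorem certZQ16_sound :
    64 * (100 / 10001 + 159900 / 2566801 + 1 / 1000 : ℝ) ≤
      ∑ i ∈ Finset.range 64, hfun (1 + ((i : ℝ) + 1) / 64) := by
  have hc := certZQ16_true
  have hSr : (0 : ℝ) < PREC := by exact_mod_cast PREC_pos
  unfold certZQ16 at hc
  split at hc
  · rename_i P hPi
    have hP := MI.mem_pi PREC hPi
    split at hc
    · rename_i T hT
      have hineq := of_decide_eq_true hc
      have hsum := sumLo_sound hP 64 le_rfl hT
      have hineqr : (64 * (PREC : ℝ)) * (100 * 2566801 * 1000 + 159900 * 10001 * 1000 +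
          10001 * 2566801) ≤ (T : ℝ) * (10001 * 2566801 * 1000) := by exact_mod_cast hineq
      have hnodes : ∑ i ∈ Finset.range 64, hfun (((65 + i : ℕ) : ℝ) / 64) =
          ∑ i ∈ Finset.range 64, hfun (1 + ((i : ℝ) + 1) / 64) := by
        refine Finset.sum_congr rfl fun i _ => ?_
        congr 1; push_cast; ring
      rw [hnodes] at hsum
      generalize ∑ i ∈ Finset.range 64, hfun (1 + ((i : ℝ) + 1) / 64) = Sg at hsum ⊢
      nlinarith
    · simp at hc
  · simp at hc

/-! ## The answer -/

/-- **`Re Z_ℚ(−16, −1/100 + i) < 0`.** [cite: LagariasRains2003, §7.3 Question 1] -/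
theorem re_ZQ_lt_zero : (ZQ wPt sPt).re < 0 := by
  have hws : wPt.re < sPt.re := by norm_num [wPt, sPt]
  have hs : sPt.re < 0 := by norm_num [sPt]
  have h3 : IntegrableOn Phi (Ioi 1) := integrableOn_thetaPowSubOne_mul hws hs
  have hA : (-1 / sPt).re = 100 / 10001 := by
    rw [show (-1 : ℂ) / sPt = -(sPt⁻¹) by rw [neg_div, one_div], neg_re, inv_re]
    simp [sPt, normSq_mk]
    norm_num
  have hB : (1 / (sPt - wPt)).re = 159900 / 2566801 := by
    have : sPt - wPt = ⟨1599 / 100, 1⟩ := by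
      apply Complex.ext <;> norm_num [sPt, wPt]
    rw [this, one_div, inv_re]
    simp [normSq_mk]
    norm_num
  have hI : (∫ t in Ioi (1 : ℝ), Phi t).re = ∫ t in Ioi (1 : ℝ), (Phi t).re := by
    have := integral_re h3
    simpa using this.symm
  have hI12 : IntegrableOn (fun t => (Phi t).re) (Ioc 1 2) := (h3.mono_set Ioc_subset_Ioi_self).re
  have hI2 : IntegrableOn (fun t => (Phi t).re) (Ioi 2) :=
    (h3.mono_set (Ioi_subset_Ioi (by norm_num))).re
  have hsplit : ∫ t in Ioi (1 : ℝ), (Phi t).re =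
      (∫ t in Ioc (1 : ℝ) 2, (Phi t).re) + ∫ t in Ioi (2 : ℝ), (Phi t).re := by
    rw [← setIntegral_union Ioc_disjoint_Ioi_same measurableSet_Ioi hI12 hI2,
      Ioc_union_Ioi_eq_Ioi (by norm_num : (1 : ℝ) ≤ 2)]
  have hmid : ∫ t in Ioc (1 : ℝ) 2, (Phi t).re = -∫ t in (1 : ℝ)..2, hfun t := by
    rw [intervalIntegral.integral_of_le (by norm_num : (1 : ℝ) ≤ 2), ← integral_neg]
    exact setIntegral_congr_fun measurableSet_Ioc fun t ht => re_Phi (zero_lt_one.trans ht.1)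
  have hR := sum_le_integral_hfun
  have hcert := certZQ16_sound
  have htail := integral_tail_lt
  have hZ : ZQ wPt sPt = -1 / sPt + 1 / (sPt - wPt) + ∫ t in Ioi (1 : ℝ), Phi t := ZQ_eq hws hs
  rw [hZ, add_re, add_re, hA, hB, hI, hsplit, hmid]
  linarith

/-- A point of `C⁻` with `Re Z_ℚ < 0`. [cite: LagariasRains2003, §7.3 Question 1] -/
theorem exists_mem_coneMinus_re_ZQ_lt_zero : ∃ p ∈ coneMinus, (ZQ p.1 p.2).re < 0 :=
  ⟨(wPt, sPt), pt_mem_coneMinus, re_ZQ_lt_zero⟩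

/-- **Answer to [LagariasRains2003, §7.3 Question 1]: no.** [cite: LagariasRains2003, §7.3 Question 1] -/
theorem not_question1 : ¬ Question1 := fun h =>
  (lt_irrefl (0 : ℝ)) ((h wPt sPt pt_mem_coneMinus).trans re_ZQ_lt_zero)

end Literature.NumberTheory.LFunctions.LagariasRains2003
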